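import Summits.QuantumFields.YangMills.Theorems.FluctuationComparisonRegPrIntLS2BetaParityBlockPartition
import HarnessLib

/-!
# S2β · D-GUARD ∕ (BG∞) — THE PARITY BLOCK PARTITION, ODD-EQUAL EDITION (block-data text v2 = v1 + ONE law): for `1 ≤ ρ`, `8ρ ≤ N` the cycle `ZMod N` is tiled by an
# EVEN number `M ≥ 8` of consecutive blocks of lengths in `[ρ, (4ρ+3)∕3]` such that ALL ODD-INDEXED BLOCKS HAVE THE SAME LENGTH — so that every stage-2 slice of the
# 8-colour gluing is a SQUARE and every stage-3 block a CUBE, as the landed square∕cube filling files (T0∕T1∕T2∕(L-T), S0∕S1∕S2∕(L-S)) require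

Cell `ym3-torus` (YM ladder rung R3 = continuum `SU(2)` Yang–Mills on the three-torus at fixed lattice data — a RUNG: NOT d = 4, NOT infinite volume,
NOT a mass gap, NOT Clay).  Width seat «width 19» `ym3-torus-px19` (gen 25, ★p1 lineage), FREE px helper on crux `stmt-QuantumFields-20520`
(`FluctuationComparisonRegPrIntL`; registry `Lines/semiclassical_s2beta.lean` UNTOUCHED, 0∕5); `--kind proof --supports stmt-QuantumFields-20520 --as helper`,
count-neutral, DEFINITION-FREE (0 `def`, 0 `instance`, 0 `notation`, 0 `sorry`, default heartbeats).  (BG∞) plan of record: UV3-NODE §116 + ADD.1∕ADD.2; binder style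
(desk RULING №127); «ROUTE SQ» (px19 g25 bus №47).

WHY (UV3-NODE §116 ADD.2, rectangle caveat).  One 1-D partition `(len, start)` of `ZMod N` serves all three axes, so a parity block `Q : Fin 3 → Fin M` has sides
`len (Q 0), len (Q 1), len (Q 2)`, which in v1 (✓`exists_parityBlocks`: `len i = c + [i < r]`) differ by one independently per axis.  The landed filling files are
SQUARE∕CUBE (`n × n`, `n × n × n`).  In the descent formulation only ODD-indexed intervals are ever the sides of a filled square (stage 2: the two odd axes) or cube
(stage 3: three odd axes); even-indexed intervals are free extents.  Hence it suffices that all odd-indexed blocks share one length `c₀` — this file's extra law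
`∀ i i′, i odd → i′ odd → len i = len i′`.

THE WITNESSES (inside the proof; nothing is defined): `q := N ∕ 2ρ ≥ 4`, `M := 2q`, `c := N ∕ M`, `r₀ := N % M` (as in v1: `ρ ≤ c`, `3c ≤ 4ρ`, `r₀ < 2q`);
odd length `c₀ := c + [q ≤ r₀]`, even remainder `r := r₀ − q·[q ≤ r₀] < q`; `len i := c₀` for odd `i`, `c + [i∕2 < r]` for even `i`;
`start i := (i∕2)·c₀ + ((i+1)∕2)·c + min ((i+1)∕2) r`; the owner map is obtained GENERICALLY from the chain laws (`exists_owner_of_chain`: the last block starting at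
or before `v.val`, by `Finset.max'`).

WHAT IS PROVED (sorry-free).
* §1 `exists_owner_of_chain` — for ANY `(len, start)` with the three chain laws and `1 ≤ M`, every `n < N` lies in some block `[start i, start i + len i)` (reusable).
* §2 arithmetic: `start_succ_even`, `start_succ_odd`, `start_last`.
* §3 ★★★ `exists_parityBlocks_oddEq (N ρ) [NeZero N] (hρ : 1 ≤ ρ) (hN : 8ρ ≤ N)` : v1's seven conclusions AND `∀ i i′ : Fin M, i.val % 2 = 1 → i′.val % 2 = 1 → len i = len i′`.

HONEST SCOPE.  Elementary `Nat`∕`ZMod`∕`Finset` arithmetic; no gauge field, no group; nothing of Bałaban's renormalisation-group analysis is asserted or proved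
([Balaban1985RegularSpaces] Lemma 1 p.79 cuts cubes of side `O(L)` — the analogous local partition in print; the torus-global parity tiling is the (BG∞) plan's, NOT in
print).  (BG∞) ∕ `hBG` ∕ `hSec` are UNPROVED; GAP♯∘, the five registered stubs (0∕5), S2β, 20520, 19936, 19200, `YM3TorusSU2` are NOT proved; rung R3 — NOT d = 4, NOT
infinite volume, NOT a mass gap, NOT Clay; the Yang–Mills mass gap is NOT proved.  Axioms standard.

References: T. Bałaban, CMP **99** (1985) 75–102 [Balaban1985RegularSpaces] (Lemma 1 p.79).
-/

set_option autoImplicit false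

namespace Summit.QuantumFields.YangMills.Theorems.FluctuationComparisonRegPrIntLS2BetaParityBlockPartitionOddEq

open Summit.QuantumFields.YangMills.Theorems.FluctuationComparisonRegPrIntLS2BetaParityBlockPartition

/-! ## §1 An owner map from the chain laws -/

/-- ★ For any chain of consecutive blocks `[start i, start i + len i)` (`start 0 = 0`, `start (i+1) = start i + len i`, `start (M−1) + len (M−1) = N`, `1 ≤ M`)
every `n < N` lies in some block: take the LAST `i` with `start i ≤ n`. [folklore] -/
theorem exists_owner_of_chain {M N : ℕ} (hM : 1 ≤ M) (len start : Fin M → ℕ)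
    (h0 : ∀ i : Fin M, (i : ℕ) = 0 → start i = 0)
    (hsucc : ∀ i j : Fin M, (j : ℕ) = (i : ℕ) + 1 → start j = start i + len i)
    (hlast : ∀ i : Fin M, (i : ℕ) + 1 = M → start i + len i = N)
    {n : ℕ} (hn : n < N) : ∃ i : Fin M, start i ≤ n ∧ n < start i + len i := by
  classical
  set S : Finset (Fin M) := Finset.univ.filter (fun i => start i ≤ n) with hSdef
  have h0mem : (⟨0, by omega⟩ : Fin M) ∈ S := by
    rw [hSdef, Finset.mem_filter]
    exact ⟨Finset.mem_univ _, by rw [h0 _ rfl]; exact Nat.zero_le _⟩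
  have hSne : S.Nonempty := ⟨_, h0mem⟩
  set i₀ := S.max' hSne with hi₀def
  have hi₀mem : i₀ ∈ S := Finset.max'_mem S hSne
  have hi₀le : start i₀ ≤ n := by
    rw [hSdef, Finset.mem_filter] at hi₀mem
    exact hi₀mem.2
  refine ⟨i₀, hi₀le, ?_⟩
  by_cases hend : (i₀ : ℕ) + 1 = M
  · rw [hlast i₀ hend]; exact hn
  · have hlt : (i₀ : ℕ) + 1 < M := by have := i₀.isLt; omega
    set j : Fin M := ⟨(i₀ : ℕ) + 1, hlt⟩ with hjdef
    have hj : start j = start i₀ + len i₀ := hsucc i₀ j rfl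
    by_contra hcon
    rw [not_lt, ← hj] at hcon
    have hjmem : j ∈ S := by
      rw [hSdef, Finset.mem_filter]; exact ⟨Finset.mem_univ _, hcon⟩
    have hjle : j ≤ i₀ := Finset.le_max' S j hjmem
    have : (j : ℕ) ≤ (i₀ : ℕ) := hjle
    simp [hjdef] at this

/-! ## §2 Arithmetic of the interleaved starts -/

/-- The start formula steps by the even length across an even index `2a`. [folklore] -/
theorem start_succ_even (a c₀ c r : ℕ) :
    ((2 * a + 1) / 2) * c₀ + ((2 * a + 1 + 1) / 2) * c + min ((2 * a + 1 + 1) / 2) r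
      = ((2 * a) / 2) * c₀ + ((2 * a + 1) / 2) * c + min ((2 * a + 1) / 2) r + (if (2 * a) / 2 < r then c + 1 else c) := by
  have h1 : (2 * a + 1) / 2 = a := by omega
  have h2 : (2 * a + 1 + 1) / 2 = a + 1 := by omega
  have h3 : (2 * a) / 2 = a := by omega
  rw [h1, h2, h3]
  by_cases har : a < r
  · rw [if_pos har, min_eq_left (by omega : a + 1 ≤ r), min_eq_left har.le]; ring
  · rw [if_neg har, min_eq_right (by omega : r ≤ a + 1), min_eq_right (by omega : r ≤ a)]; ring

/-- The start formula steps by the odd length `c₀` across an odd index `2a+1`. [folklore] -/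
theorem start_succ_odd (a c₀ c r : ℕ) :
    ((2 * a + 1 + 1) / 2) * c₀ + ((2 * a + 1 + 1 + 1) / 2) * c + min ((2 * a + 1 + 1 + 1) / 2) r
      = ((2 * a + 1) / 2) * c₀ + ((2 * a + 1 + 1) / 2) * c + min ((2 * a + 1 + 1) / 2) r + c₀ := by
  have h1 : (2 * a + 1 + 1) / 2 = a + 1 := by omega
  have h2 : (2 * a + 1 + 1 + 1) / 2 = a + 1 := by omega
  have h3 : (2 * a + 1) / 2 = a := by omega
  rw [h1, h2, h3]; ring

/-- The last block (index `2q − 1`, odd) ends at `q·c₀ + q·c + r` when `r ≤ q`. [folklore] -/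
theorem start_last (q c₀ c r : ℕ) (hq : 1 ≤ q) (hr : r ≤ q) :
    ((2 * q - 1) / 2) * c₀ + ((2 * q - 1 + 1) / 2) * c + min ((2 * q - 1 + 1) / 2) r + c₀ = q * c₀ + q * c + r := by
  have h1 : (2 * q - 1) / 2 = q - 1 := by omega
  have h2 : (2 * q - 1 + 1) / 2 = q := by omega
  rw [h1, h2, min_eq_right hr]
  obtain ⟨q', rfl⟩ : ∃ q', q = q' + 1 := ⟨q - 1, by omega⟩
  rw [Nat.add_sub_cancel]; ring

/-! ## §3 The odd-equal parity block partition exists -/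

/-- ★★★ Block-data text v2 (def-free): for `1 ≤ ρ`, `8ρ ≤ N` there are `M` (even, `≥ 8`) blocks of lengths `len : Fin M → ℕ` in `[ρ, (4ρ+3)∕3]`, consecutive starts
(`start 0 = 0`, `start (i+1) = start i + len i`, `start (M−1) + len (M−1) = N`), an owner map `owner : ZMod N → Fin M` with
`start (owner v) ≤ v.val < start (owner v) + len (owner v)`, AND all odd-indexed blocks of equal length. [cite: Balaban1985RegularSpaces, Lemma 1 p.79] -/
theorem exists_parityBlocks_oddEq (N ρ : ℕ) [NeZero N] (hρ : 1 ≤ ρ) (hN : 8 * ρ ≤ N) :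
    ∃ (M : ℕ) (len start : Fin M → ℕ) (owner : ZMod N → Fin M),
      Even M ∧ 8 ≤ M ∧ (∀ i, ρ ≤ len i ∧ 3 * len i ≤ 4 * ρ + 3) ∧
      (∀ i : Fin M, (i : ℕ) = 0 → start i = 0) ∧
      (∀ i j : Fin M, (j : ℕ) = (i : ℕ) + 1 → start j = start i + len i) ∧
      (∀ i : Fin M, (i : ℕ) + 1 = M → start i + len i = N) ∧
      (∀ v : ZMod N, start (owner v) ≤ v.val ∧ v.val < start (owner v) + len (owner v)) ∧
      (∀ i i' : Fin M, (i : ℕ) % 2 = 1 → (i' : ℕ) % 2 = 1 → len i = len i') := by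
  classical
  -- the witnesses of v1, as opaque naturals with their equations
  obtain ⟨q, hqdef⟩ : ∃ q, q = N / (2 * ρ) := ⟨_, rfl⟩
  have hq : 4 ≤ q := hqdef ▸ four_le_div_two_mul hρ hN
  obtain ⟨M, hMdef⟩ : ∃ M, M = 2 * q := ⟨_, rfl⟩
  have hM8 : 8 ≤ M := by omega
  have hMpos : 0 < M := by omega
  obtain ⟨c, hcdef⟩ : ∃ c, c = N / M := ⟨_, rfl⟩
  obtain ⟨r₀, hr₀def⟩ : ∃ r₀, r₀ = N % M := ⟨_, rfl⟩
  have hdm : M * c + r₀ = N := by rw [hcdef, hr₀def]; exact Nat.div_add_mod N M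
  have hr₀M : r₀ < M := by rw [hr₀def]; exact Nat.mod_lt N hMpos
  have hρc : ρ ≤ c := by rw [hcdef, hMdef, hqdef]; exact rho_le_div hρ hN
  have hc3 : 3 * c ≤ 4 * ρ := by rw [hcdef, hMdef, hqdef]; exact three_mul_div_le hρ hN
  -- the odd length and the even remainder
  obtain ⟨c₀, hc₀def⟩ : ∃ c₀, c₀ = (if q ≤ r₀ then c + 1 else c) := ⟨_, rfl⟩
  obtain ⟨r, hrdef⟩ : ∃ r, r = (if q ≤ r₀ then r₀ - q else r₀) := ⟨_, rfl⟩
  have hc₀c : c ≤ c₀ ∧ c₀ ≤ c + 1 := by rw [hc₀def]; split_ifs <;> constructor <;> omega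
  have hrq : r < q := by rw [hrdef]; split_ifs <;> omega
  have hsum : q * c₀ + q * c + r = N := by
    rw [hc₀def, hrdef, ← hdm, hMdef]
    split_ifs with h
    · zify [h]; ring
    · ring
  -- the data
  obtain ⟨len, hlendef⟩ : ∃ len : Fin M → ℕ, len = fun i : Fin M => if (i : ℕ) % 2 = 1 then c₀ else (if (i : ℕ) / 2 < r then c + 1 else c) := ⟨_, rfl⟩
  obtain ⟨start, hstartdef⟩ : ∃ start : Fin M → ℕ,
      start = fun i : Fin M => ((i : ℕ) / 2) * c₀ + (((i : ℕ) + 1) / 2) * c + min (((i : ℕ) + 1) / 2) r := ⟨_, rfl⟩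
  have hL0 : ∀ i : Fin M, (i : ℕ) = 0 → start i = 0 := by
    intro i hi; rw [hstartdef]; dsimp only; rw [hi]; simp
  have hLsucc : ∀ i j : Fin M, (j : ℕ) = (i : ℕ) + 1 → start j = start i + len i := by
    intro i j hij
    rw [hstartdef, hlendef]; dsimp only; rw [hij]
    obtain ⟨a, ha | ha⟩ := Nat.even_or_odd' (i : ℕ)
    · have hpar : ¬ (i : ℕ) % 2 = 1 := by omega
      rw [if_neg hpar, ha]
      exact start_succ_even a c₀ c r
    · have hpar : (i : ℕ) % 2 = 1 := by omega
      rw [if_pos hpar, ha]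
      exact start_succ_odd a c₀ c r
  have hLlast : ∀ i : Fin M, (i : ℕ) + 1 = M → start i + len i = N := by
    intro i hi
    rw [hstartdef, hlendef]; dsimp only
    have hiq : (i : ℕ) = 2 * q - 1 := by omega
    have hpar : (i : ℕ) % 2 = 1 := by omega
    rw [if_pos hpar, hiq, start_last q c₀ c r (by omega) hrq.le]
    exact hsum
  -- the owner map, generically
  have hown : ∀ v : ZMod N, ∃ i : Fin M, start i ≤ v.val ∧ v.val < start i + len i :=
    fun v => exists_owner_of_chain (by omega) len start hL0 hLsucc hLlast (ZMod.val_lt v)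
  refine ⟨M, len, start, fun v => Classical.choose (hown v), ⟨q, by omega⟩, hM8, fun i => ?_, hL0, hLsucc, hLlast,
    fun v => Classical.choose_spec (hown v), fun i i' hi hi' => ?_⟩
  · -- lengths in `[ρ, (4ρ+3)∕3]`
    rw [hlendef]; dsimp only
    split_ifs <;> constructor <;> omega
  · -- odd-indexed lengths agree
    rw [hlendef]; dsimp only
    rw [if_pos hi, if_pos hi']

end Summit.QuantumFields.YangMills.Theorems.FluctuationComparisonRegPrIntLS2BetaParityBlockPartitionOddEq
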